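import Mathlib.NumberTheory.NumberField.Basic
import Mathlib.RingTheory.Norm.Basic
import Mathlib.Tactic.FieldSimp
import Mathlib.Tactic.LinearCombination
import Literature.Computability.Complexity.CodeFPArith
import HarnessLib

/-!
# Element codes of a pure cubic field: the inverse and the sign-of-norm test in polynomial time

Topic `NumberTheory/CubicFields`; theorem-only. An element code `e = (x, y, z, den) : ℤ × ℤ × ℤ × ℕ`
(`den ≥ 1`) names the element `val e = (x + yθ + zθ₂)/den` of a pure cubic field `K = ℚ(θ)`,
`θ³ = ab²`, `θ₂ = θ²/b` (the format of `PureCubicLatticeCodes.lean`; here only the literal clause is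
used, no definition is imported). Two programs in the typed polynomial-time algebra `CodeFP`, packaged as
existence statements (program + `CodeFP` fact + specification):

* **`exists_cubic_invE`** — the inverse: with the cubic form `N = x³ + ab²y³ + a²bz³ − 3abxyz` and the
  adjugate `adj = (x² − ab·yz) + (a z² − xy)θ + (b y² − xz)θ₂` one has `(x + yθ + zθ₂)·adj = N`
  (`cubic_adj_mul_eq`, from `θ² = bθ₂`, `θθ₂ = ab`, `θ₂² = aθ`), so `(val e)⁻¹ = den·sign(N)·adj/|N|`;
  `N ≠ 0` for `val e ≠ 0` because `N` is the norm (`Algebra.norm_ne_zero_iff`);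
* **`exists_cubic_isBigL`** — for black-box programs `normE` (the norm of an element code as a fraction)
  and `lexE` (an element code attached to a lattice code), the test `0 ≤ N(10·val(lexE c) − 11)`: the code
  of `10γ − 11` is `(10x − 11·den, 10y, 10z, den)` and a fraction with positive denominator has the sign of
  its numerator (the exact "big gap" test `σ₁γ ≥ 11/10` of the cubic infrastructure walk of
  Buchmann–Williams, exact since in signature `(1,1)` the norm has the sign of the real conjugate);
* conveniences `codeFP_zadd/zsub/zmul`, **`codeFP_iterate`** (a computed step iterated a fixed number of
  times, by composition — no fold, no growth estimate).

Not here: the semantics of `normE`/`lexE` (hypotheses), lattices, logarithms.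

## References

* H. Cohen, *A Course in Computational Algebraic Number Theory*, GTM 138, Springer 1993, §6.4.5
  (pure cubic fields: integral basis `1, θ, θ²/b`, the norm form). [Cohen1993]
* S. Arora, B. Barak, *Computational Complexity: A Modern Approach*, CUP 2009, §1.3. [AroraBarak2009]
-/

namespace Literature.NumberTheory.CubicFields

open Literature.Computability.Complexity (CodeFP)
open Literature.Computability.Complexity.CodeFP (pairE natE intE bitE unE rawE fst snd const intAdd intSub
  intMul intNeg intLe intOfNat intNatAbs)

namespace PureCubicWalkOps

/-! ### Small `CodeFP` helpers -/

section Helpers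

variable {α σ β : Type} {eα : α → List Bool} {eσ : σ → List Bool} {eβ : β → List Bool}

/-- Sum of two computed integers. [folklore] -/
theorem codeFP_zadd {f g : α → ℤ} (hf : CodeFP eα intE f) (hg : CodeFP eα intE g) :
    CodeFP eα intE (fun a => f a + g a) := (intAdd.comp (hf.pair hg) :)

/-- Difference of two computed integers. [folklore] -/
theorem codeFP_zsub {f g : α → ℤ} (hf : CodeFP eα intE f) (hg : CodeFP eα intE g) :
    CodeFP eα intE (fun a => f a - g a) := (intSub.comp (hf.pair hg) :)

/-- Product of two computed integers. [folklore] -/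
theorem codeFP_zmul {f g : α → ℤ} (hf : CodeFP eα intE f) (hg : CodeFP eα intE g) :
    CodeFP eα intE (fun a => f a * g a) := (intMul.comp (hf.pair hg) :)

/-- **Iterating a computed step a fixed number of times** (with a context): by composition.
[cite: AroraBarak2009, §1.3 (composition of polynomial-time functions)] -/
theorem codeFP_iterate {F : σ × β → β} (hF : CodeFP (pairE eσ eβ) eβ F) :
    ∀ n : ℕ, CodeFP (pairE eσ eβ) eβ (fun p => (fun s => F (p.1, s))^[n] p.2)
  | 0 => (snd eσ eβ).congr fun _ => rfl
  | n + 1 => (hF.comp ((fst eσ eβ).pair (codeFP_iterate hF n))).congr fun p => by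
      rw [Function.iterate_succ_apply']

end Helpers

/-! ### The inverse of an element code -/

/-- The adjugate identity of the cubic form in the basis `(1, θ, t)` with `θ² = bt`, `θt = ab`, `t² = aθ`:
`(x + yθ + zt)·((x² − ab yz) + (a z² − xy)θ + (b y² − xz)t) = x³ + ab²y³ + a²bz³ − 3abxyz`. [cite: Cohen1993, §6.4.5] -/
theorem cubic_adj_mul_eq {K : Type} [CommRing K] (x y z a b θ t : K) (ht2 : θ ^ 2 = b * t)
    (hθt : θ * t = a * b) (htt : t * t = a * θ) :
    (x + y * θ + z * t) * ((x ^ 2 - a * b * y * z) + (a * z ^ 2 - x * y) * θ + (b * y ^ 2 - x * z) * t) =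
      x ^ 3 + a * b ^ 2 * y ^ 3 + a ^ 2 * b * z ^ 3 - 3 * a * b * x * y * z := by
  linear_combination (y * (a * z ^ 2 - x * y)) * ht2 + (y * (b * y ^ 2 - x * z) + z * (a * z ^ 2 - x * y)) * hθt +
    (z * (b * y ^ 2 - x * z)) * htt

/-- The three relations of the basis `(1, θ, θ²/b)` of a pure cubic field `θ³ = ab²`. [cite: Cohen1993, §6.4.5] -/
theorem cubic_basis_relations {K : Type} [Field K] (a b θ : K) (hb : b ≠ 0) (hθ : θ ^ 3 = a * b ^ 2) :
    θ ^ 2 = b * (θ ^ 2 / b) ∧ θ * (θ ^ 2 / b) = a * b ∧ (θ ^ 2 / b) * (θ ^ 2 / b) = a * θ := by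
  refine ⟨(mul_div_cancel₀ _ hb).symm, ?_, ?_⟩
  · rw [show θ * (θ ^ 2 / b) = θ ^ 3 / b by ring, hθ]
    field_simp
  · rw [show (θ ^ 2 / b) * (θ ^ 2 / b) = θ * θ ^ 3 / b ^ 2 by ring, hθ]
    field_simp

/-- **Correctness of the inverse formula.** For `γ = (x + yθ + zθ₂)/den ≠ 0` (`den ≥ 1`), with
`N = x³ + ab²y³ + a²bz³ − 3abxyz` and `s = ±den` of the sign of `N`: `|N| ≥ 1` and
`(s·adj)/|N| · γ = 1`. [cite: Cohen1993, §6.4.5] -/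
theorem cubic_invE_core (a b : ℕ) (K : Type) [Field K] [NumberField K] (θ : K) (hb : (b : K) ≠ 0)
    (hθ : θ ^ 3 = ((a * b ^ 2 : ℕ) : K))
    (hnorm : ∀ x y z : ℚ, Algebra.norm ℚ ((x : K) + (y : K) * θ + (z : K) * (θ ^ 2 / (b : K))) =
      x ^ 3 + (a * b ^ 2 : ℕ) * y ^ 3 + (a ^ 2 * b : ℕ) * z ^ 3 - 3 * (a * b : ℕ) * x * y * z)
    (x y z : ℤ) (den : ℕ) (hden : 1 ≤ den)
    (hγ : (((x : K) + (y : K) * θ + (z : K) * (θ ^ 2 / (b : K))) / ((den : ℕ) : K)) ≠ 0)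
    (N s : ℤ) (hN : N = x ^ 3 + (a : ℤ) * (b : ℤ) ^ 2 * y ^ 3 + (a : ℤ) ^ 2 * (b : ℤ) * z ^ 3 -
      3 * (a : ℤ) * (b : ℤ) * x * y * z)
    (hs : s = if 0 ≤ N then (den : ℤ) else -(den : ℤ)) :
    1 ≤ N.natAbs ∧
    ((((s * (x ^ 2 - (a : ℤ) * (b : ℤ) * y * z) : ℤ) : K) + (((s * ((a : ℤ) * z ^ 2 - x * y)) : ℤ) : K) * θ +
        (((s * ((b : ℤ) * y ^ 2 - x * z)) : ℤ) : K) * (θ ^ 2 / (b : K))) / ((N.natAbs : ℕ) : K)) *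
      (((x : K) + (y : K) * θ + (z : K) * (θ ^ 2 / (b : K))) / ((den : ℕ) : K)) = 1 := by
  have hθ' : θ ^ 3 = (a : K) * (b : K) ^ 2 := by rw [hθ]; push_cast; ring
  obtain ⟨ht2, hθt, htt⟩ := cubic_basis_relations (a : K) (b : K) θ hb hθ'
  have key := cubic_adj_mul_eq (x : K) (y : K) (z : K) (a : K) (b : K) θ (θ ^ 2 / (b : K)) ht2 hθt htt
  have hφ : (x : K) + (y : K) * θ + (z : K) * (θ ^ 2 / (b : K)) ≠ 0 := fun h => hγ (by rw [h, zero_div])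
  have h1 := hnorm x y z
  push_cast at h1
  have hNq : ((N : ℤ) : ℚ) = Algebra.norm ℚ ((x : K) + (y : K) * θ + (z : K) * (θ ^ 2 / (b : K))) := by
    rw [h1, hN]; push_cast; ring
  have hN0 : N ≠ 0 := by
    intro h0
    exact (Algebra.norm_ne_zero_iff (R := ℚ)).mpr hφ (by rw [← hNq, h0, Int.cast_zero])
  have hNK : ((N : ℤ) : K) = (x : K) ^ 3 + (a : K) * (b : K) ^ 2 * (y : K) ^ 3 +
      (a : K) ^ 2 * (b : K) * (z : K) ^ 3 - 3 * (a : K) * (b : K) * (x : K) * (y : K) * (z : K) := by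
    rw [hN]; push_cast; ring
  have hsNZ : s * N = (den : ℤ) * (N.natAbs : ℤ) := by
    rw [hs]
    split_ifs with h0
    · rw [Int.natAbs_of_nonneg h0]
    · rw [Int.ofNat_natAbs_of_nonpos (le_of_lt (not_le.mp h0))]; ring
  have hsN : ((s : ℤ) : K) * ((N : ℤ) : K) = ((den : ℕ) : K) * ((N.natAbs : ℕ) : K) := by
    have h := congrArg (fun t : ℤ => (t : K)) hsNZ
    simpa only [Int.cast_mul, Int.cast_natCast] using h
  have hD : ((den : ℕ) : K) ≠ 0 := by exact_mod_cast (by omega : den ≠ 0)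
  have hNa : ((N.natAbs : ℕ) : K) ≠ 0 := by exact_mod_cast (Int.natAbs_ne_zero.mpr hN0)
  refine ⟨Int.natAbs_pos.mpr hN0, ?_⟩
  rw [div_mul_div_comm, div_eq_one_iff_eq (mul_ne_zero hNa hD)]
  push_cast
  linear_combination (s : K) * key + hsN - (s : K) * hNK

/-- **The inverse program `invE`** (polynomial time on codes) and its specification: for `val e ≠ 0`,
`den(invE e) ≥ 1` and `val (invE e) · val e = 1`. [folklore] -/
theorem exists_cubic_invE :
    ∃ invE : (ℕ × ℕ) × (ℤ × ℤ × ℤ × ℕ) → ℤ × ℤ × ℤ × ℕ,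
      CodeFP (pairE (pairE natE natE) (pairE intE (pairE intE (pairE intE natE))))
        (pairE intE (pairE intE (pairE intE natE))) invE ∧
      ∀ (a b : ℕ) (K : Type) [Field K] [NumberField K] (θ : K), (b : K) ≠ 0 →
        θ ^ 3 = ((a * b ^ 2 : ℕ) : K) →
        (∀ x y z : ℚ, Algebra.norm ℚ ((x : K) + (y : K) * θ + (z : K) * (θ ^ 2 / (b : K))) =
          x ^ 3 + (a * b ^ 2 : ℕ) * y ^ 3 + (a ^ 2 * b : ℕ) * z ^ 3 - 3 * (a * b : ℕ) * x * y * z) →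
        ∀ e : ℤ × ℤ × ℤ × ℕ, 1 ≤ e.2.2.2 → (((((e).1 : ℤ) : K) + (((e).2.1 : ℤ) : K) * θ +
            (((e).2.2.1 : ℤ) : K) * (θ ^ 2 / (b : K))) / (((e).2.2.2 : ℕ) : K)) ≠ 0 →
          1 ≤ (invE ((a, b), e)).2.2.2 ∧
          (((((invE ((a, b), e)).1 : ℤ) : K) + (((invE ((a, b), e)).2.1 : ℤ) : K) * θ +
              (((invE ((a, b), e)).2.2.1 : ℤ) : K) * (θ ^ 2 / (b : K))) / (((invE ((a, b), e)).2.2.2 : ℕ) : K)) *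
            (((((e).1 : ℤ) : K) + (((e).2.1 : ℤ) : K) * θ + (((e).2.2.1 : ℤ) : K) * (θ ^ 2 / (b : K))) /
              (((e).2.2.2 : ℕ) : K)) = 1 := by
  let I := pairE (pairE natE natE) (pairE intE (pairE intE (pairE intE natE)))
  have ha : CodeFP I intE (fun p : (ℕ × ℕ) × (ℤ × ℤ × ℤ × ℕ) => (p.1.1 : ℤ)) := intOfNat.comp (fst _ _).fst'
  have hb : CodeFP I intE (fun p : (ℕ × ℕ) × (ℤ × ℤ × ℤ × ℕ) => (p.1.2 : ℤ)) := intOfNat.comp (fst _ _).snd'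
  have hx : CodeFP I intE (fun p : (ℕ × ℕ) × (ℤ × ℤ × ℤ × ℕ) => p.2.1) := (snd _ _).fst'
  have hy : CodeFP I intE (fun p : (ℕ × ℕ) × (ℤ × ℤ × ℤ × ℕ) => p.2.2.1) := (snd _ _).snd'.fst'
  have hz : CodeFP I intE (fun p : (ℕ × ℕ) × (ℤ × ℤ × ℤ × ℕ) => p.2.2.2.1) := (snd _ _).snd'.snd'.fst'
  have hdn : CodeFP I natE (fun p : (ℕ × ℕ) × (ℤ × ℤ × ℤ × ℕ) => p.2.2.2.2) := (snd _ _).snd'.snd'.snd'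
  have hd : CodeFP I intE (fun p : (ℕ × ℕ) × (ℤ × ℤ × ℤ × ℕ) => (p.2.2.2.2 : ℤ)) := intOfNat.comp hdn
  have hN : CodeFP I intE (fun p : (ℕ × ℕ) × (ℤ × ℤ × ℤ × ℕ) => p.2.1 ^ 3 + (p.1.1 : ℤ) * (p.1.2 : ℤ) ^ 2 * p.2.2.1 ^ 3 +
      (p.1.1 : ℤ) ^ 2 * (p.1.2 : ℤ) * p.2.2.2.1 ^ 3 - 3 * (p.1.1 : ℤ) * (p.1.2 : ℤ) * p.2.1 * p.2.2.1 * p.2.2.2.1) :=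
    (codeFP_zsub (codeFP_zadd (codeFP_zadd (codeFP_zmul hx (codeFP_zmul hx hx))
      (codeFP_zmul (codeFP_zmul ha (codeFP_zmul hb hb)) (codeFP_zmul hy (codeFP_zmul hy hy))))
      (codeFP_zmul (codeFP_zmul (codeFP_zmul ha ha) hb) (codeFP_zmul hz (codeFP_zmul hz hz))))
      (codeFP_zmul (codeFP_zmul (codeFP_zmul (codeFP_zmul (codeFP_zmul (const _ (3 : ℤ)) ha) hb) hx) hy) hz)).congr
      fun p => by ring
  have hs : CodeFP I intE (fun p : (ℕ × ℕ) × (ℤ × ℤ × ℤ × ℕ) =>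
      if 0 ≤ p.2.1 ^ 3 + (p.1.1 : ℤ) * (p.1.2 : ℤ) ^ 2 * p.2.2.1 ^ 3 +
          (p.1.1 : ℤ) ^ 2 * (p.1.2 : ℤ) * p.2.2.2.1 ^ 3 - 3 * (p.1.1 : ℤ) * (p.1.2 : ℤ) * p.2.1 * p.2.2.1 * p.2.2.2.1
      then (p.2.2.2.2 : ℤ) else -(p.2.2.2.2 : ℤ)) :=
    ((intLe.comp ((const _ (0 : ℤ)).pair hN)).ite hd (intNeg.comp hd)).congr fun p => by
      by_cases h : (0 : ℤ) ≤ p.2.1 ^ 3 + (p.1.1 : ℤ) * (p.1.2 : ℤ) ^ 2 * p.2.2.1 ^ 3 +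
          (p.1.1 : ℤ) ^ 2 * (p.1.2 : ℤ) * p.2.2.2.1 ^ 3 - 3 * (p.1.1 : ℤ) * (p.1.2 : ℤ) * p.2.1 * p.2.2.1 * p.2.2.2.1
      · rw [if_pos h, if_pos (decide_eq_true h)]
      · rw [if_neg h, if_neg (by simpa using h)]
  have hA : CodeFP I intE (fun p : (ℕ × ℕ) × (ℤ × ℤ × ℤ × ℕ) => p.2.1 ^ 2 - (p.1.1 : ℤ) * (p.1.2 : ℤ) * p.2.2.1 * p.2.2.2.1) :=
    (codeFP_zsub (codeFP_zmul hx hx) (codeFP_zmul (codeFP_zmul (codeFP_zmul ha hb) hy) hz)).congr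
      fun p => by ring
  have hB : CodeFP I intE (fun p : (ℕ × ℕ) × (ℤ × ℤ × ℤ × ℕ) => (p.1.1 : ℤ) * p.2.2.2.1 ^ 2 - p.2.1 * p.2.2.1) :=
    (codeFP_zsub (codeFP_zmul ha (codeFP_zmul hz hz)) (codeFP_zmul hx hy)).congr fun p => by ring
  have hC : CodeFP I intE (fun p : (ℕ × ℕ) × (ℤ × ℤ × ℤ × ℕ) => (p.1.2 : ℤ) * p.2.2.1 ^ 2 - p.2.1 * p.2.2.2.1) :=
    (codeFP_zsub (codeFP_zmul hb (codeFP_zmul hy hy)) (codeFP_zmul hx hz)).congr fun p => by ring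
  refine ⟨fun p =>
    let N : ℤ := p.2.1 ^ 3 + (p.1.1 : ℤ) * (p.1.2 : ℤ) ^ 2 * p.2.2.1 ^ 3 +
      (p.1.1 : ℤ) ^ 2 * (p.1.2 : ℤ) * p.2.2.2.1 ^ 3 - 3 * (p.1.1 : ℤ) * (p.1.2 : ℤ) * p.2.1 * p.2.2.1 * p.2.2.2.1
    let s : ℤ := if 0 ≤ N then (p.2.2.2.2 : ℤ) else -(p.2.2.2.2 : ℤ)
    (s * (p.2.1 ^ 2 - (p.1.1 : ℤ) * (p.1.2 : ℤ) * p.2.2.1 * p.2.2.2.1), s * ((p.1.1 : ℤ) * p.2.2.2.1 ^ 2 - p.2.1 * p.2.2.1),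
      s * ((p.1.2 : ℤ) * p.2.2.1 ^ 2 - p.2.1 * p.2.2.2.1), N.natAbs),
    ((codeFP_zmul hs hA).pair ((codeFP_zmul hs hB).pair ((codeFP_zmul hs hC).pair (intNatAbs.comp hN)))).congr
      fun p => rfl, ?_⟩
  intro a b K _ _ θ hb hθ hnorm e hden hγ
  obtain ⟨x, y, z, den⟩ := e
  dsimp only at hden hγ ⊢
  exact cubic_invE_core a b K θ hb hθ hnorm x y z den hden hγ _ _ rfl rfl

/-! ### The sign-of-norm (big-gap) test -/

/-- **The big-gap test `isBigL`**: `0 ≤ N(10γ − 11)` for `γ = lexE`, through `normE` of the element code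
`(10x − 11 den, 10y, 10z, den)`; given the specification of `normE` (a fraction with positive denominator equal to
the norm of the value), it decides `0 ≤ N(10·val(lexE c) − 11)`. [folklore] -/
theorem exists_cubic_isBigL (normE : (ℕ × ℕ) × (ℤ × ℤ × ℤ × ℕ) → ℤ × ℕ)
    (lexE : (ℕ × ℕ) × (ℕ × List ℤ) → ℤ × ℤ × ℤ × ℕ)
    (hnormE : CodeFP (pairE (pairE natE natE) (pairE intE (pairE intE (pairE intE natE)))) (pairE intE natE) normE)
    (hlexE : CodeFP (pairE (pairE natE natE) (pairE natE (rawE intE))) (pairE intE (pairE intE (pairE intE natE))) lexE) :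
    ∃ isBigL : (ℕ × ℕ) × (ℕ × List ℤ) → Bool,
      CodeFP (pairE (pairE natE natE) (pairE natE (rawE intE))) bitE isBigL ∧
      ∀ (a b : ℕ) (K : Type) [Field K] [NumberField K] (θ : K),
        (∀ e : ℤ × ℤ × ℤ × ℕ, 1 ≤ e.2.2.2 →
          1 ≤ (normE ((a, b), e)).2 ∧
          (((normE ((a, b), e)).1 : ℤ) : ℚ) / (((normE ((a, b), e)).2 : ℕ) : ℚ) =
            Algebra.norm ℚ (((((e).1 : ℤ) : K) + (((e).2.1 : ℤ) : K) * θ + (((e).2.2.1 : ℤ) : K) * (θ ^ 2 / (b : K))) /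
              (((e).2.2.2 : ℕ) : K))) →
        ∀ c : ℕ × List ℤ, 1 ≤ (lexE ((a, b), c)).2.2.2 →
          (isBigL ((a, b), c) = true ↔
            0 ≤ Algebra.norm ℚ ((10 : K) * (((((lexE ((a, b), c)).1 : ℤ) : K) + (((lexE ((a, b), c)).2.1 : ℤ) : K) * θ +
              (((lexE ((a, b), c)).2.2.1 : ℤ) : K) * (θ ^ 2 / (b : K))) / (((lexE ((a, b), c)).2.2.2 : ℕ) : K)) - 11)) := by
  let I := pairE (pairE natE natE) (pairE natE (rawE intE))
  have hl : CodeFP I (pairE intE (pairE intE (pairE intE natE))) lexE := hlexE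
  have hx : CodeFP I intE (fun q => (lexE q).1) := hl.fst'
  have hy : CodeFP I intE (fun q => (lexE q).2.1) := hl.snd'.fst'
  have hz : CodeFP I intE (fun q => (lexE q).2.2.1) := hl.snd'.snd'.fst'
  have hdn : CodeFP I natE (fun q => (lexE q).2.2.2) := hl.snd'.snd'.snd'
  have h10 : CodeFP I intE (fun _ => (10 : ℤ)) := const _ 10
  have h11 : CodeFP I intE (fun _ => (11 : ℤ)) := const _ 11
  have he : CodeFP I (pairE intE (pairE intE (pairE intE natE)))
      (fun q => (10 * (lexE q).1 - 11 * ((lexE q).2.2.2 : ℤ), 10 * (lexE q).2.1, 10 * (lexE q).2.2.1, (lexE q).2.2.2)) :=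
    (codeFP_zsub (codeFP_zmul h10 hx) (codeFP_zmul h11 (intOfNat.comp hdn))).pair
      ((codeFP_zmul h10 hy).pair ((codeFP_zmul h10 hz).pair hdn))
  have hn : CodeFP I intE (fun q => (normE (q.1,
      (10 * (lexE q).1 - 11 * ((lexE q).2.2.2 : ℤ), 10 * (lexE q).2.1, 10 * (lexE q).2.2.1, (lexE q).2.2.2))).1) :=
    (hnormE.comp ((fst _ _).pair he)).fst'
  refine ⟨fun q => decide (0 ≤ (normE (q.1,
      (10 * (lexE q).1 - 11 * ((lexE q).2.2.2 : ℤ), 10 * (lexE q).2.1, 10 * (lexE q).2.2.1, (lexE q).2.2.2))).1),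
    intLe.comp ((const _ (0 : ℤ)).pair hn), ?_⟩
  intro a b K _ _ θ hnorm c hden
  dsimp only
  generalize lexE ((a, b), c) = e at hden ⊢
  obtain ⟨x, y, z, den⟩ := e
  dsimp only at hden ⊢
  obtain ⟨hd, hq⟩ := hnorm (10 * x - 11 * (den : ℤ), 10 * y, 10 * z, den) hden
  dsimp only at hd hq
  have hD : ((den : ℕ) : K) ≠ 0 := by exact_mod_cast (by omega : den ≠ 0)
  have hval : ((((10 * x - 11 * (den : ℤ) : ℤ) : K) + ((10 * y : ℤ) : K) * θ + ((10 * z : ℤ) : K) * (θ ^ 2 / (b : K))) /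
      ((den : ℕ) : K)) = (10 : K) * (((x : K) + (y : K) * θ + (z : K) * (θ ^ 2 / (b : K))) / ((den : ℕ) : K)) - 11 := by
    push_cast
    generalize θ ^ 2 / (b : K) = t
    field_simp
    ring
  rw [hval] at hq
  rw [decide_eq_true_iff, ← hq]
  have hdpos : (0 : ℚ) < ((normE ((a, b), (10 * x - 11 * (den : ℤ), 10 * y, 10 * z, den))).2 : ℕ) := by
    exact_mod_cast hd
  rw [le_div_iff₀ hdpos, zero_mul]
  exact Int.cast_nonneg_iff.symm

end PureCubicWalkOps

end Literature.NumberTheory.CubicFields
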